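import Summits.AnomalousDissipation.AnomalousDissipation.Theses.MomentParity
import Summits.AnomalousDissipation.AnomalousDissipation.Theorems.ResolvedDissipation.Negative.LoadBearing
import Summits.AnomalousDissipation.AnomalousDissipation.Theorems.ResolvedDissipation.Negative.KillShape
import Literature.Analysis.FluidPDE.DoeringFoiasProofs
import Literature.Analysis.FluidPDE.DoeringFoiasPowerProofs
import Literature.Analysis.FluidPDE.LongTimeAverageNonneg
import Literature.Analysis.FluidPDE.StatisticalSolutionDirac

/-!
# Disproof of `GalerkinEnsembleRealization` — work file of the standing disprover
# (crux stmt-AnomalousDissipation-11466, route MomentParity, rank 4; cdisprove seat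
# refuter-cdisprove-stmt-AnomalousDissipation-11466-0, cycle 1, 2026-08-16)

THE CRUX (read back from the elaborated term, `galerkinEnsembleRealization_iff` below is `Iff.rfl`):
for every smooth solenoidal mean-zero force `f` and all budgets `E`, `ε` with `0 < ε` there is `M` such that
for every `ν > 0`, radius `R` and schedule `κ`: IF for infinitely many levels `N` there is a probability law
`μ` on `H = L²_σ(T³)` carried by level-`N` fields (`IsLevel`), supported in `‖u‖ ≤ R`, `κ`-resolved
(`IsResolved`), annihilating the NS generator on every band-limited CYLINDRICAL test (`IsCylStationary`;
`C¹_c` profiles — FMRT's class 𝒯, not the polynomial rows of the sibling cruxes), with `∫|u|² dμ ≤ E` and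
`ν∫‖∇u‖² dμ ≥ ε`, THEN some global Leray–Hopf solution of NS_ν forced by `f` has `meanEnergy ≤ M` and
`meanDissipation ≥ ε/2` (`Realised`).

## Findings (cycle 1)

* **NO KILL IS POSSIBLE: THE CRUX IS PROVED.** All seven stubs of the picked line `Sketch` are LANDED
  (`Theorems/MomentParityGalerkinEnsembleRealizationStub{LevelLaw,LevelDissMean,LevelDissFloor,
  LevelEnergyMeanTrunc,SupportApprox,Realisation,TimeAverages}.lean`), and the line's composition
  `galerkinEnsembleRealization_of` replayed VERBATIM against them elaborates: rc 0, 0 sorries, axioms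
  {propext, Classical.choice, Quot.sound} (`lean check`, 2026-08-16 ≈11:10Z, 12 s on cached oleans). The
  sorry-free composition is attached to the item as evidence `CandidateProof_GalerkinEnsembleRealization.lean`
  (refuters do not land positives; the lead lands it as `Theorems/MomentParity…`). Joint sufficiency of the
  stub set is therefore CHECKED, not argued. Everything below is negative KNOWLEDGE about the statement's
  shape (which clauses a proof must use, which strengthenings are false), kernel-checked, no `sorry`.
* **§1 DECORATION.** `0 < ν` is implied by the loudness clause (`ε > 0`, `ε ≤ ν·toReal(·)`):
  `galerkinEnsembleRealization_iff_without_nu_pos`. `E < 0` or `R < 0` only make the hypothesis unsatisfiable.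
* **§2 THE LAMINAR WITNESS FAMILY** (one construction serves all negatives): the Dirac law at the shear mode
  `K_{1,a} = a cos(2π x₁) e₀` (sibling file `ResolvedDissipation/Negative/ShearMode`) is, for EVERY `ν ≠ 0`, a
  level-`N` (`N ≥ 1`) ensemble of the crux for the force `K_{1, 4π²νa}`: radius `|a|`, schedule `κ ≡ 1`
  (exactly resolved), energy `a²/2`, dissipation `2π²νa²` — `isEnsemble_dirac_shearState`.
* **§3 LOAD-BEARING: the dissipation floor `ε ≤ ν∫‖∇u‖²dμ`.** Deleting it makes the statement FALSE
  (`galerkinEnsembleRealization_false_without_loud`): `f = 0`, `δ₀` is an admissible ensemble at every level,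
  while every global Leray–Hopf solution of UNFORCED NS has `meanDissipation ≤ meanPower 0 u ≤ 0 < ε/2`
  (Doering–Foias budget, in tree). So a proof must transport the floor to the limit — this is exactly where the
  `κ`-clause enters (`stub_levelDissFloor` + `exists_shiftInvariant_limit`): WITHOUT `IsResolved` the floor is
  only upper semicontinuous under `N → ∞` (enstrophy may concentrate at the cutoff shell), and the statement
  without the `κ`-clause is the OPEN leakage question of crux `ResolvedDissipation` (stmt-14284; see its
  `Cruxes/ResolvedDissipation/WhyItResists.md`): not refutable here, not provable here.
* **§4 REFUTED STRENGTHENING: `M` cannot be chosen before the budgets** (`∃ M ∀ E ε` instead of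
  `∀ E ε ∃ M`): `not_galerkinEnsembleRealization_uniformM`. Fixed force `K_{1,1}`; as `ν → 0` the laminar
  ensembles `δ_{K_{1,1/(4π²ν)}}` are admissible with `E = 1/(32π⁴ν²)`, `ε = 1/(8π²ν)`, but EVERY Leray–Hopf
  solution obeys `meanDissipation ≤ ‖f‖₂ √meanEnergy ≤ √(M/2)` (Doering–Foias), so `ε/2 = 1/(16π²ν)` is out of
  reach once `ν < 1/(16π²(√(M/2)+1))`. Reading: any admissible `M(f,E,ε)` must satisfy `M ≥ ε²/(2‖f‖₂²)`
  (`realised_energy_floor`); the line's `M = 16‖f‖₁²E²/ε² + 1` is consistent with it because admissibility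
  forces `ε ≤ ‖f‖₂√E`.
* **WHY NOTHING ELSE BITES (paper, for ideators).** Every explicitly constructible Galerkin-invariant law
  (Diracs at laminar steady states, their `N`-independence) is realised by the steady Leray–Hopf solution
  itself, with `meanEnergy = E`, `meanDissipation = ε`: the conclusion holds with room (`M = E`, floor `ε`).
  A counterexample would need a loud invariant Galerkin family whose Vishik–Fursikov limit loses HALF its
  dissipation on every path of energy `≤ M` — excluded by the landed Birkhoff–Chebyshev selection
  (`MomentParitySelection`) once the floor survives the limit, which the `κ`-clause guarantees. The strict
  Leray–Hopf class of the tree (energy inequality from `s = 0`, strong continuity at `0⁺`) was the planner's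
  `why it might fail`; it is discharged by the restart-at-a-strong-time argument of the landed
  `StubRealisation` (`IsHopfGalerkinFamily.exists_strictMono_ae_tendsto_eLpNorm` + semigroup +
  `isGlobalLerayHopf_limit`).

## Contents
§0 vocabulary + `galerkinEnsembleRealization_iff` (`Iff.rfl`) · §1 decoration (`0 < ν`) · §2 laminar Dirac
ensembles (cylindrical stationarity from `nsGeneratorPairing_shearField`) · §3 `_false_without_loud` ·
§4 `not_…_uniformM`, `realised_energy_floor` · `-- Targets`: none (all stubs of line `Sketch` landed;
`stuck_stubs = []`).
-/

noncomputable section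

-- `Summit.<Summit>.<Problem>` is the tree's mandated summit-side namespace (CONVENTIONS §2); for this
-- single-conjunct summit the two segments coincide, so the duplicate is deliberate.
set_option linter.dupNamespace false

namespace Summit.AnomalousDissipation.AnomalousDissipation.Cruxes.GalerkinEnsembleRealization.Disproof

open MeasureTheory Filter Topology
open scoped ENNReal InnerProductSpace RealInnerProductSpace
open Literature.Analysis.FunctionSpaces Literature.Analysis.FluidPDE
open Summit.AnomalousDissipation.AnomalousDissipation.Theses.MomentParity
open Summit.AnomalousDissipation.AnomalousDissipation.Theorems.QuarticGate.Negative
open Summit.AnomalousDissipation.AnomalousDissipation.Theorems.ResolvedDissipation.Negative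

/-- Local notation for the real Hilbert space `L²(T³; ℝ³)`. -/
local notation "L2T3" => Lp (EuclideanSpace ℝ (Fin 3)) 2 (volume : Measure (UnitAddTorus (Fin 3)))

/-! ## §0 Vocabulary (verbatim clauses of the crux, named) -/

/-- Stationarity against band-limited CYLINDRICAL tests (FMRT's class 𝒯: `C¹_c` profile, smooth solenoidal
mean-zero level-`N` test fields): the crux's generator clause, verbatim. [folklore] -/
def IsCylStationary (ν : ℝ) (f : T3 → R3) (N : ℕ) (μ : Measure H3) : Prop :=
  ∀ Φ : Torus.CylindricalTest (Fin 3),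
    (∀ i, ∀ k ∉ (Torus.freqBall N).erase (0 : Fin 3 → ℤ),
      UnitAddTorus.mFourierCoeff (EuclideanSpace.complexify ∘ (Φ.g i)) k = 0) →
    Integrable (fun u => Torus.nsGeneratorPairing ν f u (Φ.grad u)) μ ∧
      ∫ u, Torus.nsGeneratorPairing ν f u (Φ.grad u) ∂μ = 0

/-- A level-`N` Galerkin ensemble of the crux at `(f, ν)` with radius `R`, schedule `κ`, budgets `E, ε`:
the seven hypothesis clauses, verbatim and in order. [folklore] -/
def IsEnsemble (f : T3 → R3) (ν R : ℝ) (κ : ℕ → ℕ) (N : ℕ) (E ε : ℝ) (μ : Measure H3) : Prop :=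
  IsProbabilityMeasure μ ∧ (∀ᵐ u ∂μ, IsLevel N u) ∧ (∀ᵐ u ∂μ, ‖u‖ ≤ R) ∧ (∀ n : ℕ, IsResolved κ μ n) ∧
    IsCylStationary ν f N μ ∧ Torus.ensembleEnergy μ ≤ E ∧ ε ≤ Torus.ensembleDissipation ν μ

/-- The crux's conclusion at `(f, ν, M, ε)`: ONE global Leray–Hopf solution with `meanEnergy ≤ M` and
`meanDissipation ≥ ε/2`. [folklore] -/
def Realised (f : T3 → R3) (ν M ε : ℝ) : Prop :=
  ∃ (u₀ : T3 → R3) (u : ℝ → T3 → R3), Torus.IsGlobalLerayHopf ν (fun _ => f) u₀ u ∧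
    meanEnergy u ≤ M ∧ ε / 2 ≤ meanDissipation ν u

/-- `GalerkinEnsembleRealization` restated through the vocabulary (definitional unfolding, `Iff.rfl`). [folklore] -/
theorem galerkinEnsembleRealization_iff :
    GalerkinEnsembleRealization ↔
      ∀ f : T3 → R3, Torus.IsSmooth f → Torus.IsDivFree f → Torus.HasZeroMean f →
        ∀ E ε : ℝ, 0 < ε → ∃ M : ℝ, ∀ ν : ℝ, 0 < ν → ∀ (R : ℝ) (κ : ℕ → ℕ),
          (∃ᶠ N in atTop, ∃ μ : Measure H3, IsEnsemble f ν R κ N E ε μ) → Realised f ν M ε :=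
  Iff.rfl

/-! ## §1 Decoration: `0 < ν` is implied by the loudness clause -/

/-- Mean dissipation of a law is `≤ 0` for `ν ≤ 0` (it is `ν · toReal _`). [folklore] -/
theorem ensembleDissipation_nonpos_of_nonpos {ν : ℝ} (hν : ν ≤ 0) (μ : Measure H3) :
    Torus.ensembleDissipation ν μ ≤ 0 :=
  mul_nonpos_iff.2 (Or.inr ⟨hν, ENNReal.toReal_nonneg⟩)

/-- An ensemble with `0 < ε` has `0 < ν`. [folklore] -/
theorem IsEnsemble.nu_pos {f : T3 → R3} {ν R : ℝ} {κ : ℕ → ℕ} {N : ℕ} {E ε : ℝ} {μ : Measure H3}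
    (h : IsEnsemble f ν R κ N E ε μ) (hε : 0 < ε) : 0 < ν := by
  by_contra hle
  exact (lt_irrefl (0 : ℝ)) ((hε.trans_le h.2.2.2.2.2.2).trans_le
    (ensembleDissipation_nonpos_of_nonpos (not_lt.mp hle) μ))

/-- **DECORATION.** The crux with the clause `0 < ν` DELETED is equivalent to the crux: a loud ensemble
(`0 < ε ≤ ν · toReal _`) exists only for `ν > 0`, so backward NS / Galerkin–Euler members are excluded
automatically (information for the prover: `hν` is recovered from the hypothesis, never needed as input).
(The statement — WEAKENING 0 — `GalerkinEnsembleRealization` with `0 < ν →` deleted (all else verbatim).) [folklore] -/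
theorem galerkinEnsembleRealization_iff_without_nu_pos :
    GalerkinEnsembleRealization ↔
      ∀ f : T3 → R3, Torus.IsSmooth f → Torus.IsDivFree f → Torus.HasZeroMean f →
        ∀ E ε : ℝ, 0 < ε → ∃ M : ℝ, ∀ (ν R : ℝ) (κ : ℕ → ℕ),
          (∃ᶠ N in atTop, ∃ μ : Measure H3, IsEnsemble f ν R κ N E ε μ) → Realised f ν M ε := by
  rw [galerkinEnsembleRealization_iff]
  constructor
  · intro h f hs hd hz E ε hε
    obtain ⟨M, hM⟩ := h f hs hd hz E ε hε
    refine ⟨M, fun ν R κ hfr => ?_⟩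
    obtain ⟨N, μ, hμ⟩ := hfr.exists
    exact hM ν (hμ.nu_pos hε) R κ hfr
  · intro h f hs hd hz E ε hε
    obtain ⟨M, hM⟩ := h f hs hd hz E ε hε
    exact ⟨M, fun ν _ R κ hfr => hM ν R κ hfr⟩

/-! ## §2 The laminar witness family: Dirac laws at the shear mode `K_{1,a}`

`K_{1,a}(x) = a cos(2πx₁) e₀` is an exact steady state of NS (and of every Galerkin truncation of level
`≥ 1`) at the force `K_{1, 4π²νa}` (`nsGeneratorPairing_shearField`), so `δ_{K_{1,a}}` annihilates the
generator on EVERY smooth test field, in particular on the cylindrical class of the crux. -/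

/-- `‖[K_{M,a}]‖_H ≤ |a|` (indeed `= |a|/√2`). [folklore] -/
theorem norm_shearState_le {M : ℕ} (hM : M ≠ 0) (a : ℝ) : ‖shearState M hM a‖ ≤ |a| := by
  have h := norm_sq_shearState hM a
  have ha : |a| ^ 2 = a ^ 2 := sq_abs a
  nlinarith [norm_nonneg (shearState M hM a), abs_nonneg a]

/-- **Cylindrical stationarity of the laminar Dirac**: `δ_{K_{M,a}}` annihilates the NS generator at force
`K_{M,4π²νM²a}` on every cylindrical test (band-limited or not). [folklore] -/
theorem isCylStationary_dirac_shearState {M : ℕ} (hM : M ≠ 0) (a ν : ℝ) (N : ℕ) :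
    IsCylStationary ν (shearField M (4 * Real.pi ^ 2 * ν * (M : ℝ) ^ 2 * a)) N
      (Measure.dirac (shearState M hM a)) := by
  haveI : MeasurableSingletonClass H3 := OpensMeasurableSpace.toMeasurableSingletonClass
  intro Φ _
  refine ⟨Torus.integrable_dirac _ _, ?_⟩
  rw [integral_dirac]
  exact nsGeneratorPairing_shearField (coe_shearState_ae hM a) (Torus.CylindricalTest.isSmooth_grad_holds Φ _)

/-- The Dirac law at a level-`M` state is EXACTLY resolved by the constant schedule `κ ≡ K`, `K ≥ M`. [folklore] -/
theorem isResolved_dirac_shearState {M : ℕ} (hM : M ≠ 0) (a : ℝ) {κ : ℕ → ℕ} (hκ : ∀ n, M ≤ κ n) (n : ℕ) :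
    IsResolved κ (Measure.dirac (shearState M hM a)) n := by
  haveI : MeasurableSingletonClass H3 := OpensMeasurableSpace.toMeasurableSingletonClass
  unfold IsResolved
  rw [lintegral_dirac, lintegral_dirac,
    eGradNormSq_fourierTruncate_of_isLevel (isLevel_shearState hM a (hκ n))]
  exact le_self_add

/-- Energy of the laminar Dirac: `∫ |u|² dδ_{K_{M,a}} = a²/2`. [folklore] -/
theorem ensembleEnergy_dirac_shearState {M : ℕ} (hM : M ≠ 0) (a : ℝ) :
    Torus.ensembleEnergy (Measure.dirac (shearState M hM a)) = a ^ 2 / 2 := by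
  haveI : MeasurableSingletonClass H3 := OpensMeasurableSpace.toMeasurableSingletonClass
  unfold Torus.ensembleEnergy
  rw [integral_dirac, norm_sq_shearState hM a]

/-- Dissipation of the laminar Dirac: `ν ∫ ‖∇u‖² dδ_{K_{M,a}} = 2π²νM²a²`. [folklore] -/
theorem ensembleDissipation_dirac_shearState {M : ℕ} (hM : M ≠ 0) (a ν : ℝ) :
    Torus.ensembleDissipation ν (Measure.dirac (shearState M hM a)) =
      ν * (2 * Real.pi ^ 2 * (M : ℝ) ^ 2 * a ^ 2) := by
  haveI : MeasurableSingletonClass H3 := OpensMeasurableSpace.toMeasurableSingletonClass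
  unfold Torus.ensembleDissipation Torus.ensembleEnstrophy
  rw [lintegral_dirac, eGradNormSq_shearState hM a, ENNReal.toReal_ofReal (by positivity)]

/-- **The laminar Dirac `δ_{K_{1,a}}` is an ensemble of the crux at every level `N ≥ 1`** for the force
`K_{1,4π²νa}`, radius `|a|`, any schedule with `κ n ≥ 1`, budgets `E = a²/2`, `ε = 2π²νa²` (any `ν`). [folklore] -/
theorem isEnsemble_dirac_shearState (a ν : ℝ) {κ : ℕ → ℕ} (hκ : ∀ n, 1 ≤ κ n) {N : ℕ} (hN : 1 ≤ N) :
    IsEnsemble (shearField 1 (4 * Real.pi ^ 2 * ν * ((1 : ℕ) : ℝ) ^ 2 * a)) ν |a| κ N (a ^ 2 / 2)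
      (ν * (2 * Real.pi ^ 2 * a ^ 2)) (Measure.dirac (shearState 1 one_ne_zero a)) := by
  haveI : MeasurableSingletonClass H3 := OpensMeasurableSpace.toMeasurableSingletonClass
  refine ⟨inferInstance, ae_isLevel_dirac_shearState one_ne_zero a hN, ?_,
    isResolved_dirac_shearState one_ne_zero a hκ, isCylStationary_dirac_shearState one_ne_zero a ν N,
    (ensembleEnergy_dirac_shearState one_ne_zero a).le, ?_⟩
  · rw [ae_dirac_eq]
    simpa using norm_shearState_le one_ne_zero a
  · rw [ensembleDissipation_dirac_shearState one_ne_zero a ν]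
    simp

/-- The same family indexed by the FORCE amplitude `F` (fixed) and the viscosity: for `ν ≠ 0` the laminar
state of `K_{1,F}` is `K_{1,F/(4π²ν)}`, energy `F²/(32π⁴ν²)`, dissipation `F²/(8π²ν)`. [folklore] -/
theorem isEnsemble_dirac_laminar (F : ℝ) {ν : ℝ} (hν : ν ≠ 0) {κ : ℕ → ℕ} (hκ : ∀ n, 1 ≤ κ n) {N : ℕ}
    (hN : 1 ≤ N) :
    IsEnsemble (shearField 1 F) ν |F / (4 * Real.pi ^ 2 * ν)| κ N ((F / (4 * Real.pi ^ 2 * ν)) ^ 2 / 2)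
      (ν * (2 * Real.pi ^ 2 * (F / (4 * Real.pi ^ 2 * ν)) ^ 2))
      (Measure.dirac (shearState 1 one_ne_zero (F / (4 * Real.pi ^ 2 * ν)))) := by
  have h := isEnsemble_dirac_shearState (F / (4 * Real.pi ^ 2 * ν)) ν hκ hN
  have hF : 4 * Real.pi ^ 2 * ν * ((1 : ℕ) : ℝ) ^ 2 * (F / (4 * Real.pi ^ 2 * ν)) = F := by
    have hpi : Real.pi ≠ 0 := Real.pi_ne_zero
    field_simp
    push_cast
    ring
  rwa [hF] at h

/-! ## §3 Load-bearing: the dissipation floor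

Every global Leray–Hopf solution obeys the Doering–Foias budget `meanDissipation ≤ meanPower f u ≤ ‖f‖₂ √meanEnergy`
(in tree). With `f = 0` the right-hand side is `0`, while `δ₀ = δ_{K_{1,0}}` is an admissible ensemble. -/

/-- **The Doering–Foias budget of a global Leray–Hopf solution** (`ν > 0`, smooth mean-zero steady force):
`meanDissipation ν u ≤ ‖f‖₂ · √(meanEnergy u)`. [cite: CheskidovDoeringPetrov2006, eq. (11) and eq. (17)] -/
theorem meanDissipation_le_of_isGlobalLerayHopf {ν : ℝ} (hν : 0 < ν) {f : T3 → R3} (hf : Torus.IsSmooth f)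
    (hf0 : Torus.HasZeroMean f) {u₀ : T3 → R3} {u : ℝ → T3 → R3}
    (hu : Torus.IsGlobalLerayHopf ν (fun _ => f) u₀ u) :
    meanDissipation ν u ≤ Real.sqrt (∫ x, ‖f x‖ ^ 2) * Real.sqrt (meanEnergy u) := by
  have h1 := DoeringFoias2002_dissipation_le_power_holds hν (hf.memLp 2) hf0 u₀ u hu
  have h2 := hu.meanPower_le hν hf hf0
  rw [rmsVelocity_eq_sqrt_meanEnergy] at h2
  exact h1.trans h2

/-- **Budget of a realisation**: if `Realised f ν M ε` then `ε/2 ≤ ‖f‖₂ √(max M 0)`. [folklore] -/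
theorem Realised.half_eps_le {f : T3 → R3} (hf : Torus.IsSmooth f) (hf0 : Torus.HasZeroMean f) {ν M ε : ℝ}
    (hν : 0 < ν) (h : Realised f ν M ε) :
    ε / 2 ≤ Real.sqrt (∫ x, ‖f x‖ ^ 2) * Real.sqrt (max M 0) := by
  obtain ⟨u₀, u, hu, hM, hε⟩ := h
  refine hε.trans ((meanDissipation_le_of_isGlobalLerayHopf hν hf hf0 hu).trans ?_)
  exact mul_le_mul_of_nonneg_left (Real.sqrt_le_sqrt (hM.trans (le_max_left _ _))) (Real.sqrt_nonneg _)

/-- The shear field with zero amplitude is the zero force. [folklore] -/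
theorem shearField_amp_zero (ν : ℝ) : shearField 1 (4 * Real.pi ^ 2 * ν * ((1 : ℕ) : ℝ) ^ 2 * 0) = 0 := by
  rw [mul_zero, shearField_zero]

/-- **`δ₀` is an UNLOUD ensemble at every level for `f = 0`**: all clauses but the floor, with `R = 0`,
`E = 0` (the floor holds only for `ε ≤ 0`). [folklore] -/
theorem isEnsemble_dirac_zero (ν : ℝ) {κ : ℕ → ℕ} (hκ : ∀ n, 1 ≤ κ n) {N : ℕ} (hN : 1 ≤ N) :
    IsEnsemble (0 : T3 → R3) ν 0 κ N 0 0 (Measure.dirac (shearState 1 one_ne_zero 0)) := by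
  have h := isEnsemble_dirac_shearState 0 ν hκ hN
  rw [shearField_amp_zero] at h
  simpa using h

/-- **The dissipation floor is load-bearing.** With the clause `ε ≤ ν∫‖∇u‖²dμ` DELETED the statement is
FALSE: at `f = 0` the rest of the hypothesis is met by `δ₀` at every level (`R = 0`, `κ ≡ 1`, `E = 0`), for
every `ν`, while no global Leray–Hopf solution of unforced NS dissipates `ε/2 = 1/2` in the mean
(`meanDissipation ≤ ‖0‖₂ √meanEnergy = 0`). So any proof must carry the floor through the limit `N → ∞` —
the job of the `κ`-clause.
(The refuted statement — WEAKENING 1 — `GalerkinEnsembleRealization` without `ε ≤ ensembleDissipation ν μ` (all else verbatim).) [folklore] -/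
theorem galerkinEnsembleRealization_false_without_loud :
    ¬ (∀ f : T3 → R3, Torus.IsSmooth f → Torus.IsDivFree f → Torus.HasZeroMean f →
        ∀ E ε : ℝ, 0 < ε → ∃ M : ℝ, ∀ ν : ℝ, 0 < ν → ∀ (R : ℝ) (κ : ℕ → ℕ),
          (∃ᶠ N in atTop, ∃ μ : Measure H3, IsProbabilityMeasure μ ∧ (∀ᵐ u ∂μ, IsLevel N u) ∧
            (∀ᵐ u ∂μ, ‖u‖ ≤ R) ∧ (∀ n : ℕ, IsResolved κ μ n) ∧ IsCylStationary ν f N μ ∧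
            Torus.ensembleEnergy μ ≤ E) → Realised f ν M ε) := by
  intro h
  obtain ⟨M, hM⟩ := h 0 isSmooth_zero isDivFree_zero hasZeroMean_zero 0 1 one_pos
  have hfr : ∃ᶠ N in atTop, ∃ μ : Measure H3, IsProbabilityMeasure μ ∧ (∀ᵐ u ∂μ, IsLevel N u) ∧
      (∀ᵐ u ∂μ, ‖u‖ ≤ (0 : ℝ)) ∧ (∀ n : ℕ, IsResolved (fun _ => 1) μ n) ∧ IsCylStationary 1 0 N μ ∧
      Torus.ensembleEnergy μ ≤ 0 := by
    refine (eventually_ge_atTop 1).frequently.mono fun N hN => ?_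
    obtain ⟨h1, h2, h3, h4, h5, h6, -⟩ := isEnsemble_dirac_zero 1 (κ := fun _ => 1) (fun _ => le_rfl) hN
    exact ⟨_, h1, h2, h3, h4, h5, h6⟩
  have hb := (hM 1 one_pos 0 (fun _ => 1) hfr).half_eps_le isSmooth_zero hasZeroMean_zero one_pos
  simp at hb
  linarith

/-! ## §4 Refuted strengthening: `M` cannot precede the budgets; the realised energy floor -/

/-- `‖K_{1,1}‖₂² = 1/2`. [folklore] -/
theorem integral_norm_sq_shearField_one : ∫ x, ‖shearField 1 1 x‖ ^ 2 = 1 / 2 := by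
  rw [integral_norm_sq_shearField one_ne_zero]; norm_num

/-- **THE REALISED ENERGY FLOOR (tightness reading).** For the fixed force `K_{1,1}` and every `ν > 0` the
laminar ensemble is admissible with `E = 1/(32π⁴ν²)`, `ε = 1/(8π²ν)`; hence ANY `M` for which the crux's
implication holds at these budgets satisfies `1/(16π²ν) ≤ √(1/2)·√(max M 0)`, i.e. `M ≥ ε²/(2‖f‖₂²)`:
the realised energy ceiling cannot be below the injection scale `(ε/‖f‖₂)²` (up to the factor from `ε/2`). [folklore] -/
theorem realised_energy_floor {ν : ℝ} (hν : 0 < ν) {M : ℝ}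
    (h : ∀ (R : ℝ) (κ : ℕ → ℕ), (∃ᶠ N in atTop, ∃ μ : Measure H3,
      IsEnsemble (shearField 1 1) ν R κ N ((1 / (4 * Real.pi ^ 2 * ν)) ^ 2 / 2)
        (ν * (2 * Real.pi ^ 2 * (1 / (4 * Real.pi ^ 2 * ν)) ^ 2)) μ) →
      Realised (shearField 1 1) ν M (ν * (2 * Real.pi ^ 2 * (1 / (4 * Real.pi ^ 2 * ν)) ^ 2))) :
    1 / (16 * Real.pi ^ 2 * ν) ≤ Real.sqrt (1 / 2) * Real.sqrt (max M 0) := by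
  have hfr : ∃ᶠ N in atTop, ∃ μ : Measure H3,
      IsEnsemble (shearField 1 1) ν |1 / (4 * Real.pi ^ 2 * ν)| (fun _ => 1) N
        ((1 / (4 * Real.pi ^ 2 * ν)) ^ 2 / 2) (ν * (2 * Real.pi ^ 2 * (1 / (4 * Real.pi ^ 2 * ν)) ^ 2)) μ :=
    (eventually_ge_atTop 1).frequently.mono fun N hN =>
      ⟨_, isEnsemble_dirac_laminar 1 hν.ne' (κ := fun _ => 1) (fun _ => le_rfl) hN⟩
  have hb := (h _ _ hfr).half_eps_le (isSmooth_shearField 1 1) (hasZeroMean_shearField one_ne_zero 1) hν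
  rw [integral_norm_sq_shearField_one] at hb
  have hpi : Real.pi ≠ 0 := Real.pi_ne_zero
  have heq : ν * (2 * Real.pi ^ 2 * (1 / (4 * Real.pi ^ 2 * ν)) ^ 2) / 2 = 1 / (16 * Real.pi ^ 2 * ν) := by
    field_simp
    ring
  rwa [heq] at hb

/-- **`M` CANNOT BE CHOSEN BEFORE THE BUDGETS** (`∃ M ∀ E ε` is FALSE; so `M = M(f, E, ε)` genuinely
depends on `(E, ε)`, as the line's `16‖f‖₁²E²/ε² + 1` does): fixed force `K_{1,1}`, laminar ensembles
`δ_{K_{1,1/(4π²ν)}}` along `ν → 0` with budgets `E(ν) = 1/(32π⁴ν²)`, `ε(ν) = 1/(8π²ν)`; the Doering–Foias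
budget caps every Leray–Hopf solution of energy `≤ M` at dissipation `√(M/2)`, below `ε(ν)/2` for small `ν`.
(The refuted statement — STRENGTHENING 1 — `GalerkinEnsembleRealization` with `∃ M` moved before `∀ E ε` (all else verbatim).) [folklore] -/
theorem not_galerkinEnsembleRealization_uniformM :
    ¬ (∀ f : T3 → R3, Torus.IsSmooth f → Torus.IsDivFree f → Torus.HasZeroMean f →
        ∃ M : ℝ, ∀ E ε : ℝ, 0 < ε → ∀ ν : ℝ, 0 < ν → ∀ (R : ℝ) (κ : ℕ → ℕ),
          (∃ᶠ N in atTop, ∃ μ : Measure H3, IsEnsemble f ν R κ N E ε μ) → Realised f ν M ε) := by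
  intro h
  obtain ⟨M, hM⟩ := h (shearField 1 1) (isSmooth_shearField 1 1) (isDivFree_shearField 1 1)
    (hasZeroMean_shearField one_ne_zero 1)
  -- the small viscosity
  set S : ℝ := Real.sqrt (1 / 2) * Real.sqrt (max M 0) with hS
  have hS0 : 0 ≤ S := mul_nonneg (Real.sqrt_nonneg _) (Real.sqrt_nonneg _)
  set ν : ℝ := 1 / (16 * Real.pi ^ 2 * (S + 1)) with hν
  have hpi : 0 < Real.pi := Real.pi_pos
  have hνpos : 0 < ν := by positivity
  have hεpos : 0 < ν * (2 * Real.pi ^ 2 * (1 / (4 * Real.pi ^ 2 * ν)) ^ 2) := by positivity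
  have hfloor := realised_energy_floor hνpos (M := M) fun R κ hfr => hM _ _ hεpos ν hνpos R κ hfr
  have hval : 1 / (16 * Real.pi ^ 2 * ν) = S + 1 := by
    rw [hν]
    field_simp
  rw [hval] at hfloor
  linarith

end Summit.AnomalousDissipation.AnomalousDissipation.Cruxes.GalerkinEnsembleRealization.Disproof
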